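import Mathlib
import Literature.RingTheory.LocalCohomology.CechLowDegrees
import Literature.RingTheory.LocalCohomology.CechFormalSections

/-!
# Idempotent Čech `0`-cocycles: lifting along nil-thickenings, and the cocycle of a splitting

Route `SkinnerWilesDefectOne`, crux `ReducibleOrdinaryProModular` (stmt-Langlands-12919), line
`fine-selmer-codimension-two`, stub (R) `stub_raynaudConnectedness` = Grothendieck's connectedness
theorem [SGA 2 XIII 2.1].  The lead's proof of that theorem (c3) replaces the local Lefschetz step
(SGA 2 IX–X, "Lef(X, Y) ⟹ π₀(Y') = π₀(X')") by an ALGEBRAIC statement about the ordered Čech complex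
`Č(y; -)` of the tree (`Literature/RingTheory/LocalCohomology/Cech*.lean`).  This file supplies the two
elementary ingredients about idempotent `0`-cocycles of an `R`-algebra `A` (sections of `𝒪` over the
open `⋃ D(y_i)`):

* `Theorems.isNilpotent_of_locMap_eq_zero` — if `φ : A' → A` is an algebra map with nil kernel, the
  kernel of `A'_{y_t} → A_{y_t}` is nil;
* `Theorems.exists_isIdempotentElem_locMap_eq`, `Theorems.eq_of_locMap_eq_of_isIdempotentElem` —
  idempotents of `A_{y_t}` lift uniquely to `A'_{y_t}` when `φ` is onto with nil kernel (Mathlib's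
  `exists_isIdempotentElem_eq_of_ker_isNilpotent`, Stacks 00J9, on the localisations);
* `Theorems.exists_idempotent_cocycle_lift` — hence an idempotent `0`-COCYCLE of `A` lifts to an
  idempotent `0`-cocycle of `A'` (uniqueness glues the local lifts on `D(y_i y_j)`): the topological
  invariance of `π₀` under nil-thickenings, in Čech form;
* `Theorems.isIdempotentElem_splittingCocycle`, `Theorems.dC_splittingCocycle` — if `a_i b_j = 0` and `y_i^K = a_i + b_i` in `A` (a "splitting of
  `⋃ D(y_i)` into the loci `b = 0` and `a = 0`"), then `t ↦ b_{t0} / y_{t0}^K` is an idempotent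
  `0`-cocycle.

Everything is elementary fraction calculus; no local cohomology beyond the tree's definitions is used.
Registered sub-goal of this file: `stub_raynaudConnectedness_auxIdempotentCocycleLift` (§5).  No definitions are introduced.

References: A. Grothendieck, SGA 2, Exp. IX §1, Exp. XIII §2 [Grothendieck1968SGA2]; The Stacks
Project, Tag 00J9 (lifting idempotents), Tag 01FG (ordered Čech complex) [StacksProject].
-/

set_option linter.dupNamespace false -- project-wide option (lakefile weak.linter.dupNamespace); `Summit.Langlands.Langlands` is the mandated namespace
set_option autoImplicit false

noncomputable section

namespace Summit.Langlands.Langlands.Theorems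

open Literature.RingTheory.LocalCohomology

universe u

variable {R : Type u} [CommRing R] {s : ℕ} (y : Fin s → R)
variable {A A' : Type u} [CommRing A] [Algebra R A] [CommRing A'] [Algebra R A']

/-! ## 1. Powers of fractions; nil kernels localise -/

/-- `(m/p)^k = m^k/p^k` in the localised algebra `A_{y_t}`. [folklore] -/
theorem cechLoc_mk_pow {n : ℕ} (t : Fin n → Fin s) (a : A)
    (p : Submonoid.powers (tupleProd y t)) (k : ℕ) :
    (LocalizedModule.mk a p : CechLoc y A t) ^ k = LocalizedModule.mk (a ^ k) (p ^ k) := by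
  induction k with
  | zero => rw [pow_zero, pow_zero, pow_zero, one_eq_mk_one]
  | succ k ih => rw [pow_succ, ih, LocalizedModule.mk_mul_mk, ← pow_succ, ← pow_succ]

/-- **Nil kernels localise**: if the algebra map `φ : A' → A` has nil kernel, every element of
`A'_{y_t}` mapping to `0` in `A_{y_t}` is nilpotent. [folklore] -/
theorem isNilpotent_of_locMap_eq_zero (φ : A' →ₐ[R] A)
    (hφ : ∀ x : A', φ x = 0 → IsNilpotent x) {n : ℕ} (t : Fin n → Fin s)
    (z : CechLoc y A' t) (hz : locMap y φ.toLinearMap t z = 0) : IsNilpotent z := by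
  induction z using LocalizedModule.induction_on with | h a p => ?_
  rw [locMap_mk, ← LocalizedModule.zero_mk p, LocalizedModule.mk_eq] at hz
  obtain ⟨u, hu⟩ := hz
  have hu' : ((u : R) * (p : R)) • φ a = 0 := by
    simpa [Submonoid.smul_def, mul_smul] using hu
  have hker : φ (((u : R) * (p : R)) • a) = 0 := by rw [map_smul]; exact hu'
  obtain ⟨m, hm⟩ := hφ _ hker
  refine ⟨m, ?_⟩
  have hmk : (LocalizedModule.mk a p : CechLoc y A' t) =
      LocalizedModule.mk (((u : R) * (p : R)) • a) ((u * p) * p) := by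
    rw [← LocalizedModule.mk_cancel_common_left (u * p) p a, Submonoid.smul_def, Submonoid.coe_mul]
  rw [hmk, cechLoc_mk_pow, hm, LocalizedModule.zero_mk]

/-! ## 2. Idempotents of `A_{y_t}` lift uniquely along a surjection with nil kernel -/

/-- **Idempotents lift** along `A'_{y_t} → A_{y_t}` when `φ : A' → A` is onto with nil kernel
(Stacks 00J9 applied to the localisation). [cite: StacksProject, Tag 00J9] -/
theorem exists_isIdempotentElem_locMap_eq (φ : A' →ₐ[R] A) (hsurj : Function.Surjective φ)
    (hφ : ∀ x : A', φ x = 0 → IsNilpotent x) {n : ℕ} (t : Fin n → Fin s)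
    (e : CechLoc y A t) (he : IsIdempotentElem e) :
    ∃ e' : CechLoc y A' t, IsIdempotentElem e' ∧ locMap y φ.toLinearMap t e' = e := by
  -- the induced map as a ring homomorphism (the tree records multiplicativity of `locMap`)
  let F : CechLoc y A' t →+* CechLoc y A t :=
    { toFun := locMap y φ.toLinearMap t
      map_one' := locMap_one y φ t
      map_mul' := locMap_mul y φ t
      map_zero' := map_zero _
      map_add' := map_add _ }
  have hF : ∀ z, F z = locMap y φ.toLinearMap t z := fun _ => rfl
  have hker : ∀ x ∈ RingHom.ker F, IsNilpotent x := fun x hx =>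
    isNilpotent_of_locMap_eq_zero y φ hφ t x (by rw [← hF]; exact hx)
  have hrange : e ∈ F.range := by
    obtain ⟨z, hz⟩ := locMap_surjective y φ.toLinearMap hsurj t e
    exact ⟨z, by rw [hF, hz]⟩
  obtain ⟨e', he', he'e⟩ := exists_isIdempotentElem_eq_of_ker_isNilpotent _ hker e hrange he
  exact ⟨e', he', by rw [← hF, he'e]⟩

/-- **Uniqueness of idempotent lifts**: two idempotents of `A'_{y_t}` with the same image in
`A_{y_t}` are equal when `φ` has nil kernel. [cite: StacksProject, Tag 00J9] -/
theorem eq_of_locMap_eq_of_isIdempotentElem (φ : A' →ₐ[R] A)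
    (hφ : ∀ x : A', φ x = 0 → IsNilpotent x) {n : ℕ} (t : Fin n → Fin s)
    {e₁ e₂ : CechLoc y A' t} (h₁ : IsIdempotentElem e₁) (h₂ : IsIdempotentElem e₂)
    (h : locMap y φ.toLinearMap t e₁ = locMap y φ.toLinearMap t e₂) : e₁ = e₂ :=
  eq_of_isNilpotent_sub_of_isIdempotentElem h₁ h₂
    (isNilpotent_of_locMap_eq_zero y φ hφ t _ (by rw [map_sub, h, sub_self]))

/-! ## 3. Lifting idempotent `0`-cocycles -/

/-- Restriction maps preserve idempotency. [folklore] -/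
theorem isIdempotentElem_res {n n' : ℕ} (t : Fin n → Fin s) (θ : Fin n' → Fin n)
    {e : CechLoc y A (t ∘ θ)} (he : IsIdempotentElem e) : IsIdempotentElem (res y A t θ e) := by
  unfold IsIdempotentElem at *
  rw [← res_mul, he]

/-- The two faces of a `0`-cocycle agree on `D(y_i y_j)`. [folklore] -/
theorem res_eq_res_of_dC_zero_eq_zero {M : Type u} [AddCommGroup M] [Module R M]
    (c : CechObj y M 0) (hc : dC 0 c = 0) (t : Fin 2 → Fin s) :
    res y M t (Fin.succAbove 0) (c (t ∘ Fin.succAbove 0)) =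
      res y M t (Fin.succAbove 1) (c (t ∘ Fin.succAbove 1)) := by
  have h := congrFun hc t
  rw [dC_pair] at h
  exact sub_eq_zero.mp h

/-- Naturality of restriction along the maps induced by `φ`, on elements. [folklore] -/
theorem res_locMap_apply {M N : Type u} [AddCommGroup M] [Module R M] [AddCommGroup N] [Module R N]
    (ψ : M →ₗ[R] N) {n n' : ℕ} (t : Fin n → Fin s) (θ : Fin n' → Fin n) (z : CechLoc y M (t ∘ θ)) :
    res y N t θ (locMap y ψ (t ∘ θ) z) = locMap y ψ t (res y M t θ z) :=
  congrArg (fun f => f z) (congrArg DFunLike.coe (res_comp_locMap y ψ t θ))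

/-- **Idempotent `0`-cocycles lift along nil-thickenings.**  Let `φ : A' → A` be a surjective
algebra homomorphism with nil kernel and `e ∈ Č⁰(y; A)` a cocycle (`d e = 0`) all of whose components
`e_t ∈ A_{y_t}` are idempotent.  Then `e` is the image of a cocycle `e' ∈ Č⁰(y; A')` with idempotent
components.  (Each `e_t` lifts uniquely to an idempotent; on `D(y_i y_j)` the two restrictions are
idempotents with the same image, hence equal.)  This is the invariance of `π₀` of the open
`⋃ D(y_i)` under nilpotent thickenings, in Čech form. [cite: Grothendieck1968SGA2, Exp. IX §1] -/
theorem exists_idempotent_cocycle_lift (φ : A' →ₐ[R] A) (hsurj : Function.Surjective φ)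
    (hφ : ∀ x : A', φ x = 0 → IsNilpotent x) (e : CechObj y A 0) (he : dC 0 e = 0)
    (hid : ∀ t, IsIdempotentElem (e t)) :
    ∃ e' : CechObj y A' 0, cechObjMap y φ.toLinearMap 0 e' = e ∧ dC 0 e' = 0 ∧
      ∀ t, IsIdempotentElem (e' t) := by
  choose e' he' he'e using fun t => exists_isIdempotentElem_locMap_eq y φ hsurj hφ t (e t) (hid t)
  refine ⟨e', funext fun t => by rw [cechObjMap_apply]; exact he'e t, ?_, he'⟩
  funext t
  rw [dC_pair, Pi.zero_apply, sub_eq_zero]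
  apply eq_of_locMap_eq_of_isIdempotentElem y φ hφ t (isIdempotentElem_res y _ _ (he' _))
    (isIdempotentElem_res y _ _ (he' _))
  rw [← res_locMap_apply, ← res_locMap_apply, he'e, he'e]
  exact res_eq_res_of_dC_zero_eq_zero y e he t

/-! ## 4. The idempotent cocycle of a splitting -/

/-- For a tuple of length one, `y_t = y_{t 0}`. [folklore] -/
theorem tupleProd_fin_one (t : Fin 1 → Fin s) : tupleProd y t = y (t 0) := by
  simp [tupleProd]

/-- The power `y_t^K` lies in the submonoid of powers (the denominator of the splitting cocycle).
[folklore] -/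
theorem pow_mem_powers_tupleProd {n : ℕ} (t : Fin n → Fin s) (K : ℕ) :
    tupleProd y t ^ K ∈ Submonoid.powers (tupleProd y t) := ⟨K, rfl⟩

/-- **The cochain of a splitting is idempotent**: if `a_i b_i = 0` and `y_i^K = a_i + b_i` then
`(b_i / y_i^K)^2 = b_i / y_i^K` in `A_{y_i}`. [folklore] -/
theorem isIdempotentElem_splittingCocycle (K : ℕ) (a b : Fin s → A)
    (hab : ∀ i, a i * b i = 0) (hsum : ∀ i, algebraMap R A (y i) ^ K = a i + b i)
    (t : Fin 1 → Fin s) :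
    IsIdempotentElem (LocalizedModule.mk (b (t 0)) ⟨tupleProd y t ^ K, pow_mem_powers_tupleProd y t K⟩ :
      CechLoc y A t) := by
  unfold IsIdempotentElem
  rw [LocalizedModule.mk_mul_mk]
  have hbb : b (t 0) * b (t 0) =
      (⟨tupleProd y t ^ K, pow_mem_powers_tupleProd y t K⟩ : Submonoid.powers (tupleProd y t)) •
        b (t 0) := by
    rw [Submonoid.smul_def]
    change _ = (tupleProd y t ^ K) • b (t 0)
    rw [tupleProd_fin_one, Algebra.smul_def, map_pow, hsum, add_mul, hab, zero_add]
  rw [hbb, LocalizedModule.mk_cancel_common_left]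

/-- **The cochain of a splitting is a cocycle**: if `a_i b_j = 0` for all `i, j` and
`y_i^K = a_i + b_i`, then `b_i / y_i^K = b_j / y_j^K` on `D(y_i y_j)` (both equal
`b_i b_j / (y_i y_j)^K`). [folklore] -/
theorem dC_splittingCocycle (K : ℕ) (a b : Fin s → A)
    (hab : ∀ i j, a i * b j = 0) (hsum : ∀ i, algebraMap R A (y i) ^ K = a i + b i) :
    dC 0 (fun t => LocalizedModule.mk (b (t 0)) ⟨tupleProd y t ^ K, pow_mem_powers_tupleProd y t K⟩ :
      CechObj y A 0) = 0 := by
  funext t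
  rw [dC_pair, Pi.zero_apply, sub_eq_zero]
  set u₀ : Fin 1 → Fin s := t ∘ Fin.succAbove 0 with hu₀
  set u₁ : Fin 1 → Fin s := t ∘ Fin.succAbove 1 with hu₁
  have e₀ : u₀ 0 = t 1 := rfl
  have e₁ : u₁ 0 = t 0 := rfl
  have h0 : tupleProd y u₀ = y (t 1) := by rw [tupleProd_fin_one, e₀]
  have h1 : tupleProd y u₁ = y (t 0) := by rw [tupleProd_fin_one, e₁]
  -- clear the denominator `(y_{t0} y_{t1})^K = y_{u₁}^K · y_{u₀}^K`
  apply eq_of_smul_coe_eq (y := y) (M := A) (u := t) (t := t) ⟨1, by rw [pow_one]⟩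
    ⟨tupleProd y t ^ K, pow_mem_powers_tupleProd y t K⟩
  have hsplit : ((⟨tupleProd y t ^ K, pow_mem_powers_tupleProd y t K⟩ :
      Submonoid.powers (tupleProd y t)) : R) =
      ((⟨tupleProd y u₁ ^ K, pow_mem_powers_tupleProd y u₁ K⟩ : Submonoid.powers (tupleProd y u₁)) : R) *
      ((⟨tupleProd y u₀ ^ K, pow_mem_powers_tupleProd y u₀ K⟩ : Submonoid.powers (tupleProd y u₀)) : R) := by
    change tupleProd y t ^ K = tupleProd y u₁ ^ K * tupleProd y u₀ ^ K
    rw [h0, h1, tupleProd_two, mul_pow]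
  have key : ∀ i j : Fin s, algebraMap R A (y i) ^ K * b j = b i * b j := fun i j => by
    rw [hsum, add_mul, hab, zero_add]
  conv_lhs => rw [hsplit, mul_smul, smul_res_mk, LocalizedModule.smul'_mk]
  conv_rhs => rw [hsplit, mul_comm, mul_smul, smul_res_mk, LocalizedModule.smul'_mk]
  congr 1
  change tupleProd y u₁ ^ K • b (u₀ 0) = tupleProd y u₀ ^ K • b (u₁ 0)
  rw [h0, h1, e₀, e₁, Algebra.smul_def, Algebra.smul_def, map_pow, map_pow, key, key, mul_comm]

end Summit.Langlands.Langlands.Theorems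

/-! ## 5. The registered sub-goal (verbatim signature) -/

namespace Summit.Langlands.Langlands.Cruxes.ReducibleOrdinaryProModular.FineSelmerCodimensionTwo

/-- **Registered sub-goal `stub_raynaudConnectedness_auxIdempotentCocycleLift` of stub (R)
`stub_raynaudConnectedness`** (c3, SGA 2 XIII 2.1 programme, step (G5a)): idempotent Čech
`0`-cocycles lift along surjective algebra maps with nil kernel — `Theorems.exists_idempotent_cocycle_lift`
at universe `0`. [cite: Grothendieck1968SGA2, Exp. IX §1] -/
theorem stub_raynaudConnectedness_auxIdempotentCocycleLift :
    ∀ (R : Type) [CommRing R] (s : ℕ) (y : Fin s → R) (A A' : Type) [CommRing A] [Algebra R A] [CommRing A'] [Algebra R A'] (φ : A' →ₐ[R] A), Function.Surjective φ → (∀ x : A', φ x = 0 → IsNilpotent x) → ∀ e : Literature.RingTheory.LocalCohomology.CechObj y A 0, Literature.RingTheory.LocalCohomology.dC 0 e = 0 → (∀ t, IsIdempotentElem (e t)) → ∃ e' : Literature.RingTheory.LocalCohomology.CechObj y A' 0, Literature.RingTheory.LocalCohomology.cechObjMap y φ.toLinearMap 0 e' = e ∧ Literature.RingTheory.LocalCohomology.dC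 0 e' = 0 ∧ ∀ t, IsIdempotentElem (e' t) :=
  fun _R _ _s y _A _A' _ _ _ _ φ hs hn e he hid =>
    Summit.Langlands.Langlands.Theorems.exists_idempotent_cocycle_lift y φ hs hn e he hid

end Summit.Langlands.Langlands.Cruxes.ReducibleOrdinaryProModular.FineSelmerCodimensionTwo

end
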